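import Summits.NavierStokesRegularity.NavierStokesRegularity.Theorems.ExtremiserTransienceKStarAttainedPerturbation
import HarnessLib

/-!
# Route `ExtremiserTransience`, support item `KStarAttained` (stmt-NavierStokesRegularity-24370):
# THE EULER–LAGRANGE EQUATION OF AN ATTAINER OF `κ⋆` HOLDS OFF THE CONTACT SET

`--supports stmt-NavierStokesRegularity-24370`. Author: prover seat `ns-et-p1` (g3).

The item asks whether the sharp depletion constant `κ⋆ = sInf V` (`V` = the universal constants of
`|∫⟪ω, Dv ω⟫| ≤ κ·M·‖ω‖₂·‖∇ω‖₂` on the admissible class: `C^∞`, divergence free, `|v| ≤ M`, bounded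
gradient, `D⁰v, D¹v, D²v ∈ L²`) is ATTAINED: `|J(v)| = κ⋆·M·‖ω‖₂·‖∇ω‖₂` with `M‖ω‖₂‖∇ω‖₂ > 0`. The item's
informal says «the sup-norm constraint `|v| ≤ M` makes the functional non-smooth, so the Euler–Lagrange route
is unavailable». This file shows the opposite on the NON-CONTACT set `U = {x : ‖v x‖ < M}`: there the constraint
is slack, every compactly supported smooth divergence-free perturbation `φ` with `tsupport φ ⊆ U` keeps
`v + εφ` admissible WITH THE SAME BOUND `M` for `|ε|` small, and since `κ⋆` is universal
(`DepletionLadder.sharpDepletion_is_universal`) the polynomial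
`ε ↦ J(v+εφ)² − κ⋆² M² ‖curl(v+εφ)‖₂² ‖∇curl(v+εφ)‖₂²` (degree `6`) is `≤ 0` near `0` and `= 0` at `0`,
so its linear coefficient vanishes:

* `KStar.firstVariation_eq_of_normBound` — the first-variation identity under a norm bound
  `‖v + εφ‖ ≤ (1 + mε)·M` for `|ε| < ε₀` (any real `m`):
  `J·J₁(φ) = κ⋆²·M²·(m·Z·W + W·a₁(φ) + Z·c₁(φ))`, where `J = ∫⟪ω, Dv ω⟫`, `Z = ‖ω‖₂²`, `W = ‖∇ω‖₂²`, and
  `J₁(φ) = ∫ (⟪curl φ, Dv ω⟫ + ⟪ω, Dφ ω⟫ + ⟪ω, Dv curl φ⟫)`, `a₁(φ) = ∫⟪ω, curl φ⟫`,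
  `c₁(φ) = ∫ Σᵢ ⟪∂ᵢω, ∂ᵢ curl φ⟫` are the linear coefficients of `J`, `Z`, `W` along `v + εφ`;
* `KStar.firstVariation_eq_zero_offContact` — **the Euler–Lagrange equation off the contact set**: for
  `tsupport φ ⊆ {‖v‖ < M}` the case `m = 0` applies, `J·J₁(φ) = κ⋆²·M²·(W·a₁(φ) + Z·c₁(φ))`.

(The `m = 1` case — perturbations equal to `v` near the contact set — is what a follow-up uses to show that the
contact set `{‖v‖ = M}` of a smooth attainer has nonempty interior.)
WHAT THIS IS NOT: neither attainment nor non-attainment of `κ⋆` is proved; the item stays open; nothing about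
Navier–Stokes solutions is asserted and NS regularity is NOT proved by anything here. [folklore]
-/

noncomputable section

open Set Filter Topology MeasureTheory
open scoped InnerProductSpace RealInnerProductSpace ENNReal NNReal ContDiff
open Literature.Analysis.FluidPDE

namespace Summit.NavierStokesRegularity.NavierStokesRegularity.Theorems

-- the problem directory repeats the summit name (`NavierStokesRegularity/NavierStokesRegularity`)
set_option linter.dupNamespace false

namespace DepletionLadder.KStar

variable {v φ : EuclideanSpace ℝ (Fin 3) → EuclideanSpace ℝ (Fin 3)}

/-! ## The calculus step: the linear coefficient of a polynomial `≤ 0` near `0`, `= 0` at `0`, vanishes -/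

/-- If `(J + εJ₁ + ε²J₂ + ε³J₃)² ≤ K²((1+mε)M)²(Z + 2εa₁ + ε²a₂)(W + 2εc₁ + ε²c₂)` for `|ε| < ε₁` with
equality at `ε = 0`, then the `ε`-derivative of the difference vanishes at `0`:
`J·J₁ = K²M²(m Z W + W a₁ + Z c₁)` (Fermat's theorem on stationary points, `IsLocalMax.hasDerivAt_eq_zero`). [folklore] -/
theorem linear_coeff_eq_of_sq_le {J J₁ J₂ J₃ K M m Z a₁ a₂ W c₁ c₂ ε₁ : ℝ} (hε₁ : 0 < ε₁)
    (hf0 : J ^ 2 = K ^ 2 * M ^ 2 * Z * W)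
    (hle : ∀ ε, |ε| < ε₁ → (J + ε * J₁ + ε ^ 2 * J₂ + ε ^ 3 * J₃) ^ 2 ≤
        K ^ 2 * ((1 + m * ε) * M) ^ 2 * (Z + 2 * ε * a₁ + ε ^ 2 * a₂) * (W + 2 * ε * c₁ + ε ^ 2 * c₂)) :
    J * J₁ = K ^ 2 * M ^ 2 * (m * Z * W + W * a₁ + Z * c₁) := by
  set f : ℝ → ℝ := fun ε => (J + ε * J₁ + ε ^ 2 * J₂ + ε ^ 3 * J₃) ^ 2 -
    K ^ 2 * ((1 + m * ε) * M) ^ 2 * (Z + 2 * ε * a₁ + ε ^ 2 * a₂) * (W + 2 * ε * c₁ + ε ^ 2 * c₂) with hf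
  have hmax : IsLocalMax f 0 := by
    have hf00 : f 0 = 0 := by simp only [hf]; linear_combination hf0
    filter_upwards [Ioo_mem_nhds (neg_lt_zero.2 hε₁) hε₁] with ε hε
    rw [hf00]
    exact sub_nonpos.2 (hle ε (abs_lt.2 hε))
  have hA : HasDerivAt (fun ε : ℝ => J + ε * J₁ + ε ^ 2 * J₂ + ε ^ 3 * J₃) J₁ 0 := by
    have h := ((((hasDerivAt_id' (0 : ℝ)).mul_const J₁).const_add J).add
      ((hasDerivAt_pow 2 (0 : ℝ)).mul_const J₂)).add ((hasDerivAt_pow 3 (0 : ℝ)).mul_const J₃)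
    exact h.congr_deriv (by simp)
  have hP : HasDerivAt (fun ε : ℝ => ((1 + m * ε) * M) ^ 2) (2 * m * M ^ 2) 0 := by
    have h := ((((hasDerivAt_id' (0 : ℝ)).const_mul m).const_add 1).mul_const M).pow 2
    exact h.congr_deriv (by simp; ring)
  have hZ : HasDerivAt (fun ε : ℝ => Z + 2 * ε * a₁ + ε ^ 2 * a₂) (2 * a₁) 0 := by
    have h := (((((hasDerivAt_id' (0 : ℝ)).const_mul 2).mul_const a₁).const_add Z)).add
      ((hasDerivAt_pow 2 (0 : ℝ)).mul_const a₂)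
    exact h.congr_deriv (by simp)
  have hW : HasDerivAt (fun ε : ℝ => W + 2 * ε * c₁ + ε ^ 2 * c₂) (2 * c₁) 0 := by
    have h := (((((hasDerivAt_id' (0 : ℝ)).const_mul 2).mul_const c₁).const_add W)).add
      ((hasDerivAt_pow 2 (0 : ℝ)).mul_const c₂)
    exact h.congr_deriv (by simp)
  have hF : HasDerivAt f (2 * J * J₁ - K ^ 2 * (2 * m * M ^ 2 * Z * W + M ^ 2 * (2 * a₁) * W +
      M ^ 2 * Z * (2 * c₁))) 0 := by
    have h := (hA.pow 2).sub ((((hP.const_mul (K ^ 2)).mul hZ).mul hW))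
    exact h.congr_deriv (by simp; ring)
  have h0 := hmax.hasDerivAt_eq_zero hF
  linarith

/-! ## The first variation of an attainer -/

/-- **First variation of an attainer under a norm bound.** Let `(v, M, B)` be admissible and ATTAIN the
sharp constant, `|J| = κ⋆·M·‖ω‖₂·‖∇ω‖₂` (`κ⋆ = sInf V`), and let `φ ∈ C^∞_c` be divergence free with
`‖v + εφ‖ ≤ (1 + mε)·M` everywhere for `|ε| < ε₀`. Since `κ⋆` is universal
(`DepletionLadder.sharpDepletion_is_universal`) and `v + εφ` is admissible with bound `(1+mε)M`,
`J(v+εφ)² ≤ κ⋆²(1+mε)²M²·Z(v+εφ)·W(v+εφ)` with equality at `ε = 0`; the three quantities are polynomials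
in `ε` (`integral_stretching_add_smul`, `integral_normSq_curl_add_smul`, `integral_frobeniusNormSq_add_smul`),
so the linear coefficient of the difference vanishes:
`J·J₁(φ) = κ⋆²·M²·(m·Z·W + W·a₁(φ) + Z·c₁(φ))`. [folklore] -/
theorem firstVariation_eq_of_normBound (hv : ContDiff ℝ ∞ v) (hdiv : VectorCalculus.IsDivFree v)
    {M B : ℝ} (hB : ∀ x, ‖fderiv ℝ v x‖ ≤ B) (h0 : ∫⁻ x, ‖iteratedFDeriv ℝ 0 v x‖ₑ ^ 2 < ⊤)
    (h1 : ∫⁻ x, ‖iteratedFDeriv ℝ 1 v x‖ₑ ^ 2 < ⊤) (h2 : ∫⁻ x, ‖iteratedFDeriv ℝ 2 v x‖ₑ ^ 2 < ⊤)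
    (hatt : |∫ x, ⟪curl v x, fderiv ℝ v x (curl v x)⟫| =
      sInf {κ : ℝ | (∀ (v : EuclideanSpace ℝ (Fin 3) → EuclideanSpace ℝ (Fin 3)) (M B : ℝ), ContDiff ℝ (⊤ : ℕ∞) v → Literature.Analysis.FluidPDE.VectorCalculus.IsDivFree v → (∀ x, ‖v x‖ ≤ M) → (∀ x, ‖fderiv ℝ v x‖ ≤ B) → (∫⁻ x, ‖iteratedFDeriv ℝ 0 v x‖ₑ ^ 2 < ⊤) → (∫⁻ x, ‖iteratedFDeriv ℝ 1 v x‖ₑ ^ 2 < ⊤) → (∫⁻ x, ‖iteratedFDeriv ℝ 2 v x‖ₑ ^ 2 < ⊤) → |∫ x, ⟪Literature.Analysis.FluidPDE.curl v x, fderiv ℝ v x (Literature.Analysis.FluidPDE.curl v x)⟫_ℝ| ≤ κ * M * Real.sqrt (∫ x, ‖Literature.Analysis.FluidPDE.curl v x‖ ^ 2) * Real.sqrt (∫ x, Literature.Analysis.FluidPDE.frobeniusNormSq (fderiv ℝ (Literature.Analysis.FluidPDE.curl v) x)))} * M * Real.sqrt (∫ x, ‖curl v x‖ ^ 2) *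
        Real.sqrt (∫ x, frobeniusNormSq (fderiv ℝ (curl v) x)))
    (hφ : ContDiff ℝ ∞ φ) (hφc : HasCompactSupport φ) (hφdiv : VectorCalculus.IsDivFree φ)
    {m ε₀ : ℝ} (hε₀ : 0 < ε₀) (hbound : ∀ ε : ℝ, |ε| < ε₀ → ∀ x, ‖v x + ε • φ x‖ ≤ (1 + m * ε) * M) :
    (∫ x, ⟪curl v x, fderiv ℝ v x (curl v x)⟫) * (∫ x, (⟪curl φ x, fderiv ℝ v x (curl v x)⟫ + ⟪curl v x, fderiv ℝ φ x (curl v x)⟫ +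
          ⟪curl v x, fderiv ℝ v x (curl φ x)⟫)) =
      sInf {κ : ℝ | (∀ (v : EuclideanSpace ℝ (Fin 3) → EuclideanSpace ℝ (Fin 3)) (M B : ℝ), ContDiff ℝ (⊤ : ℕ∞) v → Literature.Analysis.FluidPDE.VectorCalculus.IsDivFree v → (∀ x, ‖v x‖ ≤ M) → (∀ x, ‖fderiv ℝ v x‖ ≤ B) → (∫⁻ x, ‖iteratedFDeriv ℝ 0 v x‖ₑ ^ 2 < ⊤) → (∫⁻ x, ‖iteratedFDeriv ℝ 1 v x‖ₑ ^ 2 < ⊤) → (∫⁻ x, ‖iteratedFDeriv ℝ 2 v x‖ₑ ^ 2 < ⊤) → |∫ x, ⟪Literature.Analysis.FluidPDE.curl v x, fderiv ℝ v x (Literature.Analysis.FluidPDE.curl v x)⟫_ℝ| ≤ κ * M * Real.sqrt (∫ x, ‖Literature.Analysis.FluidPDE.curl v x‖ ^ 2) * Real.sqrt (∫ x, Literature.Analysis.FluidPDE.frobeniusNormSq (fderiv ℝ (Literature.Analysis.FluidPDE.curl v) x)))} ^ 2 * M ^ 2 * (m * (∫ x, ‖curl v x‖ ^ 2) * (∫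 x, frobeniusNormSq (fderiv ℝ (curl v) x)) + (∫ x, frobeniusNormSq (fderiv ℝ (curl v) x)) * (∫ x, ⟪curl v x, curl φ x⟫) + (∫ x, ‖curl v x‖ ^ 2) * (∫ x, ∑ i, ⟪fderiv ℝ (curl v) x (EuclideanSpace.basisFun (Fin 3) ℝ i),
          fderiv ℝ (curl φ) x (EuclideanSpace.basisFun (Fin 3) ℝ i)⟫)) := by
  have huniv := DepletionLadder.sharpDepletion_is_universal
  set K : ℝ := sInf {κ : ℝ | (∀ (v : EuclideanSpace ℝ (Fin 3) → EuclideanSpace ℝ (Fin 3)) (M B : ℝ), ContDiff ℝ (⊤ : ℕ∞) v → Literature.Analysis.FluidPDE.VectorCalculus.IsDivFree v → (∀ x, ‖v x‖ ≤ M) → (∀ x, ‖fderiv ℝ v x‖ ≤ B) → (∫⁻ x, ‖iteratedFDeriv ℝ 0 v x‖ₑ ^ 2 < ⊤) → (∫⁻ x, ‖iteratedFDeriv ℝ 1 v x‖ₑ ^ 2 < ⊤) → (∫⁻ x, ‖iteratedFDeriv ℝ 2 v x‖ₑ ^ 2 < ⊤) → |∫ x, ⟪Literature.Analysis.FluidPDE.curl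 v x, fderiv ℝ v x (Literature.Analysis.FluidPDE.curl v x)⟫_ℝ| ≤ κ * M * Real.sqrt (∫ x, ‖Literature.Analysis.FluidPDE.curl v x‖ ^ 2) * Real.sqrt (∫ x, Literature.Analysis.FluidPDE.frobeniusNormSq (fderiv ℝ (Literature.Analysis.FluidPDE.curl v) x)))} with hK
  have hZ0 : 0 ≤ (∫ x, ‖curl v x‖ ^ 2) := integral_nonneg fun x => sq_nonneg _
  have hW0 : 0 ≤ (∫ x, frobeniusNormSq (fderiv ℝ (curl v) x)) := integral_nonneg fun x => frobeniusNormSq_nonneg _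
  refine linear_coeff_eq_of_sq_le hε₀
    (J₂ := ∫ x, (⟪curl φ x, fderiv ℝ φ x (curl v x)⟫ + ⟪curl φ x, fderiv ℝ v x (curl φ x)⟫ +
      ⟪curl v x, fderiv ℝ φ x (curl φ x)⟫))
    (J₃ := ∫ x, ⟪curl φ x, fderiv ℝ φ x (curl φ x)⟫) (a₂ := ∫ x, ‖curl φ x‖ ^ 2)
    (c₂ := ∫ x, frobeniusNormSq (fderiv ℝ (curl φ) x)) ?_ fun ε hε => ?_
  · calc (∫ x, ⟪curl v x, fderiv ℝ v x (curl v x)⟫) ^ 2 = |∫ x, ⟪curl v x, fderiv ℝ v x (curl v x)⟫| ^ 2 := (sq_abs _).symm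
      _ = (K * M * Real.sqrt (∫ x, ‖curl v x‖ ^ 2) * Real.sqrt (∫ x, frobeniusNormSq (fderiv ℝ (curl v) x))) ^ 2 := by rw [hatt]
      _ = K ^ 2 * M ^ 2 * (∫ x, ‖curl v x‖ ^ 2) * (∫ x, frobeniusNormSq (fderiv ℝ (curl v) x)) := by
          rw [mul_pow, mul_pow, mul_pow, Real.sq_sqrt hZ0, Real.sq_sqrt hW0]
  · obtain ⟨hcd, hdv, ⟨B', hB'⟩, h0', h1', h2'⟩ := admissible_add_smul hv hdiv hB h0 h1 h2 hφ hφc hφdiv ε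
    have hu := huniv _ ((1 + m * ε) * M) B' hcd hdv (hbound ε hε) hB' h0' h1' h2'
    have hZε : 0 ≤ ∫ x, ‖curl (fun y => v y + ε • φ y) x‖ ^ 2 := integral_nonneg fun x => sq_nonneg _
    have hWε : 0 ≤ ∫ x, frobeniusNormSq (fderiv ℝ (curl (fun y => v y + ε • φ y)) x) :=
      integral_nonneg fun x => frobeniusNormSq_nonneg _
    have hsq : (∫ x, ⟪curl (fun y => v y + ε • φ y) x,
        fderiv ℝ (fun y => v y + ε • φ y) x (curl (fun y => v y + ε • φ y) x)⟫) ^ 2 ≤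
        (K * ((1 + m * ε) * M) * Real.sqrt (∫ x, ‖curl (fun y => v y + ε • φ y) x‖ ^ 2) *
          Real.sqrt (∫ x, frobeniusNormSq (fderiv ℝ (curl (fun y => v y + ε • φ y)) x))) ^ 2 := by
      rw [← sq_abs (∫ x, ⟪curl (fun y => v y + ε • φ y) x,
        fderiv ℝ (fun y => v y + ε • φ y) x (curl (fun y => v y + ε • φ y) x)⟫)]
      exact pow_le_pow_left₀ (abs_nonneg _) hu 2
    rw [mul_pow, mul_pow, mul_pow, Real.sq_sqrt hZε, Real.sq_sqrt hWε,
      integral_stretching_add_smul hv hB h1 hφ hφc ε, integral_normSq_curl_add_smul hv h1 hφ hφc ε,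
      integral_frobeniusNormSq_add_smul hv h2 hφ hφc ε] at hsq
    exact hsq

/-- The sup-norm slack off the contact set: if `tsupport φ ⊆ {‖v‖ < M}` (and `‖v‖ ≤ M`), then
`‖v + εφ‖ ≤ M` everywhere for all `|ε| < ε₀`, some `ε₀ > 0`. [folklore] -/
theorem norm_add_smul_le_of_tsupport_subset (hv : ContDiff ℝ ∞ v) {M : ℝ} (hM : ∀ x, ‖v x‖ ≤ M)
    (hφ : ContDiff ℝ ∞ φ) (hφc : HasCompactSupport φ) (hsupp : tsupport φ ⊆ {x | ‖v x‖ < M}) :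
    ∃ ε₀ : ℝ, 0 < ε₀ ∧ ∀ ε : ℝ, |ε| < ε₀ → ∀ x, ‖v x + ε • φ x‖ ≤ (1 + (0 : ℝ) * ε) * M := by
  obtain ⟨C, hC⟩ := hφ.continuous.bounded_above_of_compact_support hφc
  have hC0 : 0 ≤ C := (norm_nonneg _).trans (hC 0)
  -- a uniform gap `δ` on the support
  obtain ⟨δ, hδ, hgap⟩ : ∃ δ : ℝ, 0 < δ ∧ ∀ x ∈ tsupport φ, ‖v x‖ ≤ M - δ := by
    rcases (tsupport φ).eq_empty_or_nonempty with he | hne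
    · exact ⟨1, one_pos, fun x hx => by simp [he] at hx⟩
    · obtain ⟨x₀, hx₀, hmax⟩ := hφc.exists_isMaxOn hne (continuous_norm.comp hv.continuous).continuousOn
      have hlt : ‖v x₀‖ < M := hsupp hx₀
      exact ⟨M - ‖v x₀‖, sub_pos.2 hlt, fun x hx => by
        have h' : ‖v x‖ ≤ ‖v x₀‖ := hmax hx
        linarith⟩
  refine ⟨δ / (C + 1), div_pos hδ (by linarith), fun ε hε x => ?_⟩
  rw [zero_mul, add_zero, one_mul]
  by_cases hx : x ∈ tsupport φ
  · have hεC : |ε| * ‖φ x‖ ≤ δ := by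
      calc |ε| * ‖φ x‖ ≤ δ / (C + 1) * C := mul_le_mul hε.le (hC x) (norm_nonneg _) (by positivity)
        _ ≤ δ := by
            rw [div_mul_eq_mul_div, div_le_iff₀ (by linarith)]
            nlinarith
    calc ‖v x + ε • φ x‖ ≤ ‖v x‖ + ‖ε • φ x‖ := norm_add_le _ _
      _ = ‖v x‖ + |ε| * ‖φ x‖ := by rw [norm_smul, Real.norm_eq_abs]
      _ ≤ (M - δ) + δ := add_le_add (hgap x hx) hεC
      _ = M := by ring
  · rw [image_eq_zero_of_notMem_tsupport hx, smul_zero, add_zero]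
    exact hM x

/-- **THE EULER–LAGRANGE EQUATION OFF THE CONTACT SET.** Let `(v, M, B)` be admissible with `‖v‖ ≤ M` and
attain the sharp constant `κ⋆ = sInf V`: `|∫⟪ω, Dv ω⟫| = κ⋆·M·‖ω‖₂·‖∇ω‖₂`. Then for every `φ ∈ C^∞_c`,
divergence free, supported in the non-contact set `{x : ‖v x‖ < M}`,
`J·J₁(φ) = κ⋆²·M²·(W·a₁(φ) + Z·c₁(φ))` — the weak Euler–Lagrange equation of the functional
`J²/(M²·Z·W)` at `v`, tested against `φ`. (When `J ≠ 0`, equivalently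
`J₁(φ)/J = a₁(φ)/Z + c₁(φ)/W`, i.e. `d/dε log (J²/(Z W)) = 0`.) [folklore] -/
theorem firstVariation_eq_zero_offContact (hv : ContDiff ℝ ∞ v) (hdiv : VectorCalculus.IsDivFree v)
    {M B : ℝ} (hM : ∀ x, ‖v x‖ ≤ M) (hB : ∀ x, ‖fderiv ℝ v x‖ ≤ B)
    (h0 : ∫⁻ x, ‖iteratedFDeriv ℝ 0 v x‖ₑ ^ 2 < ⊤)
    (h1 : ∫⁻ x, ‖iteratedFDeriv ℝ 1 v x‖ₑ ^ 2 < ⊤) (h2 : ∫⁻ x, ‖iteratedFDeriv ℝ 2 v x‖ₑ ^ 2 < ⊤)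
    (hatt : |∫ x, ⟪curl v x, fderiv ℝ v x (curl v x)⟫| =
      sInf {κ : ℝ | (∀ (v : EuclideanSpace ℝ (Fin 3) → EuclideanSpace ℝ (Fin 3)) (M B : ℝ), ContDiff ℝ (⊤ : ℕ∞) v → Literature.Analysis.FluidPDE.VectorCalculus.IsDivFree v → (∀ x, ‖v x‖ ≤ M) → (∀ x, ‖fderiv ℝ v x‖ ≤ B) → (∫⁻ x, ‖iteratedFDeriv ℝ 0 v x‖ₑ ^ 2 < ⊤) → (∫⁻ x, ‖iteratedFDeriv ℝ 1 v x‖ₑ ^ 2 < ⊤) → (∫⁻ x, ‖iteratedFDeriv ℝ 2 v x‖ₑ ^ 2 < ⊤) → |∫ x, ⟪Literature.Analysis.FluidPDE.curl v x, fderiv ℝ v x (Literature.Analysis.FluidPDE.curl v x)⟫_ℝ| ≤ κ * M * Real.sqrt (∫ x, ‖Literature.Analysis.FluidPDE.curl v x‖ ^ 2) * Real.sqrt (∫ x, Literature.Analysis.FluidPDE.frobeniusNormSq (fderiv ℝ (Literature.Analysis.FluidPDE.curl v) x)))} * M * Real.sqrt (∫ x, ‖curl v x‖ ^ 2) *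
        Real.sqrt (∫ x, frobeniusNormSq (fderiv ℝ (curl v) x)))
    (hφ : ContDiff ℝ ∞ φ) (hφc : HasCompactSupport φ) (hφdiv : VectorCalculus.IsDivFree φ)
    (hsupp : tsupport φ ⊆ {x | ‖v x‖ < M}) :
    (∫ x, ⟪curl v x, fderiv ℝ v x (curl v x)⟫) * (∫ x, (⟪curl φ x, fderiv ℝ v x (curl v x)⟫ + ⟪curl v x, fderiv ℝ φ x (curl v x)⟫ +
          ⟪curl v x, fderiv ℝ v x (curl φ x)⟫)) =
      sInf {κ : ℝ | (∀ (v : EuclideanSpace ℝ (Fin 3) → EuclideanSpace ℝ (Fin 3)) (M B : ℝ), ContDiff ℝ (⊤ : ℕ∞) v → Literature.Analysis.FluidPDE.VectorCalculus.IsDivFree v → (∀ x, ‖v x‖ ≤ M) → (∀ x, ‖fderiv ℝ v x‖ ≤ B) → (∫⁻ x, ‖iteratedFDeriv ℝ 0 v x‖ₑ ^ 2 < ⊤) → (∫⁻ x, ‖iteratedFDeriv ℝ 1 v x‖ₑ ^ 2 < ⊤) → (∫⁻ x, ‖iteratedFDeriv ℝ 2 v x‖ₑ ^ 2 < ⊤)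 → |∫ x, ⟪Literature.Analysis.FluidPDE.curl v x, fderiv ℝ v x (Literature.Analysis.FluidPDE.curl v x)⟫_ℝ| ≤ κ * M * Real.sqrt (∫ x, ‖Literature.Analysis.FluidPDE.curl v x‖ ^ 2) * Real.sqrt (∫ x, Literature.Analysis.FluidPDE.frobeniusNormSq (fderiv ℝ (Literature.Analysis.FluidPDE.curl v) x)))} ^ 2 * M ^ 2 * ((∫ x, frobeniusNormSq (fderiv ℝ (curl v) x)) * (∫ x, ⟪curl v x, curl φ x⟫) + (∫ x, ‖curl v x‖ ^ 2) * (∫ x, ∑ i, ⟪fderiv ℝ (curl v) x (EuclideanSpace.basisFun (Fin 3) ℝ i),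
          fderiv ℝ (curl φ) x (EuclideanSpace.basisFun (Fin 3) ℝ i)⟫)) := by
  obtain ⟨ε₀, hε₀, hbound⟩ := norm_add_smul_le_of_tsupport_subset hv hM hφ hφc hsupp
  have h := firstVariation_eq_of_normBound hv hdiv hB h0 h1 h2 hatt hφ hφc hφdiv hε₀ hbound
  rw [h]
  ring

end DepletionLadder.KStar

end Summit.NavierStokesRegularity.NavierStokesRegularity.Theorems

end
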